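import Summits.BirchSwinnertonDyer.Rank1Residual.Partition.Corners
import Literature.NumberTheory.EllipticCurves.Rank1Residual.X9NoEntry
import HarnessLib

/-!
# The strong partial theorem on the good ORDINARY axis at `p ≥ 5` with SHARP hypothesis lists
# (cell `b2b-bsdres`, RESIDUAL-MAP.md §A CORNER PREDICATE; rmap-1 gen 5)

HONEST FRAMING (run/shared/lean/b2b/bsd-rank1-residual/, verbatim in every file): the goal of the
cell is to DELETE the COMBINATION-SHAPED residual classes of the Birch–Swinnerton-Dyer formula for
ALL analytic-rank `≤ 1` elliptic curves over `ℚ` — "full BSD formula for every rank `≤ 1` curve in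
class `C`" assembled STRICTLY from published theorems — so that the rank-`≤ 1` remainder becomes
exactly the CONSTRUCTION-SHAPED classes, which are TYPED (missing-input `Prop`s), NOT attempted.
This is not "finishing BSD". Theorems only; NO definition, NO named fact introduced here; every
published theorem enters as one of the tree's existing named Literature facts BY NAME; nothing
about any particular curve is asserted; no label changes.

`Partition/Corners.lean` (rmap-1 gen 2) states the §A headline — non-CM `E/ℚ` of analytic rank
`≤ 1`, odd good ORDINARY `p`, outside the corners X1 / X9 / X10b ⇒ `BSD(E,p)` — from the FOURTEEN
named facts of `Partition/Bsdp.lean`, because it is cut out of the all-axes disjunction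
`bsdp_or_residualV3_or_classX11b`. Referee-2 GEN 66's informational nit `cornersAll-flagged-binders`
observed that most of those binders are idle on a given axis and that their PUB\* flags then ride
along for nothing; `Partition/CornersLargePrime.lean` (rmap-1 gen 4) answered it at `p ≥ 11`.
This file answers it on the WHOLE `p ≥ 5` part of the good ordinary axis (RESIDUAL-MAP §A rows
'surjective 5, 7, ≥ 11', 'irreducible not surjective 5, 7', and the three reducible rows), where the
corner is `ClassX1 ∨ ClassX9` (X10b needs `p = 3`):

* irreducible branch — outside X9 the image is onto (`surj_of_irr_of_not_classX9`: at a good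
  ordinary `p ≥ 5` the X9 predicate IS '¬cm ∧ ord ∧ p ≥ 5 ∧ irr ∧ ¬surj', its rank clause being
  automatic, `classX9_iff`), then (im) by Serre's lifting lemma (`X9.bigIm_of_surj`) and row C2 =
  Burungale–Castella–Skinner 2025 Cor. 1.3.1: TWO named facts (`hBCS` PUB\*, `hGZK`) —
  `bsdp_goodOrd_of_irr_of_not_classX9_sharp`;
* reducible branch — outside X1 the pair is in row C6 (Castella–Grossi–Skinner 2025 Thm. D, off
  the anomalous line) or row C7 (the Greenberg–Vatsal 2000 Thm. 1.3 + Greenberg 1999 Thm. 4.1 + Kato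
  chain, rank `0` with GV parity): x1a's `bsdp_of_not_classX1`, SIX named facts (`hCGS`, `hGV`,
  `hGr`, `hmod`, `hmodP`, `hGZK`).

So the §A headline at `p ≥ 5` needs SEVEN named facts (`bsdp_goodOrd_of_five_le_sharp`), NINE for
every curve, CM included (`…_allCurves_sharp`: + Rubin 1991 ∧ Burungale–Flach 2024 `hCM`, Kobayashi
2013 Cor. 1.4 `hKob`), and EIGHT on the coordinator's domain 'good ordinary, or multiplicative with
`r = 0`' at `p ≥ 5` (`bsdp_goodOrd_or_mult_of_five_le_sharp`: + Skinner 2016 Thm. C `hSk`). The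
binders that DROP relative to `Corners.bsdp_goodOrd_of_not_corner` are `hJSW` (JSW 2017 Thm. 1.2.1:
flags `JSW-ss`, travelling `Hid04-gap` of referee R123.2), `hYZ` (Yan–Zhu 2026: `YZ26@3-BF-ERL-Ohta`),
`hW20` (Wuthrich 2014 Lemma 20), `hLLT` (Li–Liu–Tian 2024) and, off the CM branch, `hCM` / `hKob`:
NONE of their flags rides on the `p ≥ 5` good-ordinary headline. The flags that DO ride:
`BCS25-IMC-equiv@BSTW` with `hBCS` (+ the informational provenance items (β) `Wan15-Thm103-Fujiwara`
and (γ) `[Hid04, Thm 3.2]` via Wan 2015 Prop. 96, RESIDUAL-MAP §A, before the referee),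
`CGS25-BST-Thm311` with `hCGS` (informational), `GV-chain` with `hGV`/`hGr` (literal),
`KOB13-primary-unread` with `hKob` (CM rank one only). No mark of RESIDUAL-MAP moves; this is
hypothesis bookkeeping for the kernel-verified headline (coordinator ruling (A), 2026-08-20T22:22Z:
'whose hypotheses are the published theorems typed as named facts with citation tags').

References: RESIDUAL-MAP.md §A (table rows at `p ∈ {5, 7, ≥ 11}`, CORNER PREDICATE, register
T3/T7/T8/T9), §I HEADLINE; HOME/PARTITION.md §3; `Partition/Corners.lean`,
`Partition/CornersLargePrime.lean`, `X9/PartitionF2.lean` (`bsdp_of_cor131_of_surj`),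
`Literature/…/Rank1Residual/EisensteinGoodComplement.lean` (`bsdp_of_not_classX1`),
`Literature/…/Rank1Residual/X9NoEntry.lean` (`classX9_iff`).
-/

namespace Summit.BirchSwinnertonDyer.Rank1Residual

open WeierstrassCurve Literature.NumberTheory.EllipticCurves
  Literature.NumberTheory.EllipticCurves.Rank1Residual Literature.NumberTheory.EllipticCurves.ModularForms
open scoped NumberField

section Curve

variable {W : WeierstrassCurve ℚ} [W.IsElliptic] [W.IsGloballyMinimal] {p : ℕ} [Fact p.Prime]

/-! ### The irreducible branch: outside X9 the image is big -/

/-- **Outside X9, irreducible means surjective** (non-CM, good ordinary `p ≥ 5`): the class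
predicate `ClassX9 W p` is equivalent to `¬cm ∧ ord(p) ∧ p ≥ 5 ∧ irr(p) ∧ ¬surj(p)` — its rank-one
clause '`r = 1 → ¬sst`' is automatic by Serre 1972 Prop. 21 (`classX9_iff`) — so its negation, with
the first four conjuncts given, is `surj(p)`. [folklore] -/
theorem surj_of_irr_of_not_classX9 (hcm : ¬ W.HasCM) (hgo : GoodOrd W p) (h5 : 5 ≤ p)
    (hirr : Irr W p) (hX9 : ¬ ClassX9 W p) : Surj W p := by
  by_contra hns
  exact hX9 ((classX9_iff W p).mpr ⟨hcm, hgo, h5, hirr, hns⟩)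

/-- **Outside X9, irreducible means (im)** (non-CM, good ordinary `p ≥ 5`): surjectivity
(`surj_of_irr_of_not_classX9`) and Serre's lifting lemma (`X9.bigIm_of_surj`, `p ≥ 5`) give the
big-image hypothesis (im) of Burungale–Castella–Skinner 2025 as the tree states it. [folklore] -/
theorem bigIm_of_irr_of_not_classX9 (hcm : ¬ W.HasCM) (hgo : GoodOrd W p) (h5 : 5 ≤ p)
    (hirr : Irr W p) (hX9 : ¬ ClassX9 W p) : BigIm W p :=
  X9.bigIm_of_surj W p h5 (surj_of_irr_of_not_classX9 hcm hgo h5 hirr hX9)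

/-- **SHARP, irreducible branch: TWO named facts.** For a non-CM `E/ℚ` of analytic rank `≤ 1`, a
good ordinary prime `p ≥ 5` with `E[p]` irreducible and `(E, p)` not in X9, `BSD(E,p)` follows from
Burungale–Castella–Skinner 2025 Cor. 1.3.1 (`hBCS`; PUB\*, flag `BCS25-IMC-equiv@BSTW` travels) and
Gross–Zagier–Kolyvagin (`hGZK`) alone — row C2, with (irr) given and (im) DISCHARGED
(`bsdp_of_cor131_of_surj`). This is RESIDUAL-MAP §A row 'surjective, p ∈ {5, 7, ≥ 11}' (both
ranks) stated by its complement inside 'irreducible'. [folklore] -/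
theorem bsdp_goodOrd_of_irr_of_not_classX9_sharp
    (hBCS : BurungaleCastellaSkinner2025.cor131_padicValRat_bsd_rank_le_one)
    (hGZK : rank_eq_analyticRank_of_analyticRank_le_one)
    (hcm : ¬ W.HasCM) (hr : W.analyticRank ≤ 1) (hgo : GoodOrd W p) (h5 : 5 ≤ p) (hirr : Irr W p)
    (hX9 : ¬ ClassX9 W p) : BSDp W p :=
  bsdp_of_cor131_of_surj W p hBCS hGZK hcm h5 hgo (surj_of_irr_of_not_classX9 hcm hgo h5 hirr hX9) hr

/-! ### The whole good ordinary axis at `p ≥ 5` -/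

/-- **SHARP §A HEADLINE at `p ≥ 5`, non-CM: SEVEN named facts.** For every non-CM `E/ℚ` (globally
minimal `W`) of analytic rank `≤ 1` and every good ORDINARY prime `p ≥ 5`, `BSD(E,p)` holds unless
`(E, p)` lies in the corner X1 (Eisenstein ANOMALOUS: `red ∧ anom ∧ ¬(r = 0 ∧ gvpar)`) or X9 (image
`5Ns/5S4/7Ns`, `p ∈ {5, 7}`), granted: Burungale–Castella–Skinner 2025 Cor. 1.3.1 (`hBCS`, PUB\*),
GZK (`hGZK`), Castella–Grossi–Skinner 2025 Thm. D (`hCGS`, informational flag `CGS25-BST-Thm311`),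
Greenberg–Vatsal 2000 Thm. 1.3 (`hGV`) with Greenberg 1999 Thm. 4.1 in rank `0` (`hGr`; literal flag
`GV-chain`), modularity (`hmod`, `hmodP`). Irreducible branch: `bsdp_goodOrd_of_irr_of_not_classX9_sharp`;
reducible branch: x1a's `bsdp_of_not_classX1` (rows C6/C7). Same conclusion as
`Corners.bsdp_goodOrd_of_not_corner` restricted to `p ≥ 5`, with the idle binders `hSk`, `hJSW`,
`hYZ`, `hW20`, `hLLT`, `hCM`, `hKob` dropped — in particular neither `JSW-ss` / `Hid04-gap` (JSW) nor
`YZ26@3-BF-ERL-Ohta` rides on this statement. [folklore] -/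
theorem bsdp_goodOrd_of_five_le_sharp
    (hBCS : BurungaleCastellaSkinner2025.cor131_padicValRat_bsd_rank_le_one)
    (hGZK : rank_eq_analyticRank_of_analyticRank_le_one)
    (hCGS : CastellaGrossiSkinner2025.thmD_padicValRat_bsd_rank_le_one)
    (hGV : GreenbergVatsal2000.thm13_charIdeal_eq_of_gvPar) (hGr : greenberg_charValue_rankZero)
    (hmod : hasEntireLFunction_rat) (hmodP : nonempty_modularParametrizationData)
    (hcm : ¬ W.HasCM) (hr : W.analyticRank ≤ 1) (hgo : GoodOrd W p) (h5 : 5 ≤ p)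
    (hX1 : ¬ ClassX1 W p) (hX9 : ¬ ClassX9 W p) : BSDp W p := by
  by_cases hirr : Irr W p
  · exact bsdp_goodOrd_of_irr_of_not_classX9_sharp hBCS hGZK hcm hr hgo h5 hirr hX9
  · exact bsdp_of_not_classX1 hCGS hGV hGr hmod hmodP hGZK W p (by omega) hgo.1 hirr hr hX1

/-- **The partition form at `p ≥ 5` (non-CM, good ordinary): `BSD(E,p) ∨ X1 ∨ X9`** from the same
seven named facts. [folklore] -/
theorem bsdp_or_classX1_or_classX9_of_five_le
    (hBCS : BurungaleCastellaSkinner2025.cor131_padicValRat_bsd_rank_le_one)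
    (hGZK : rank_eq_analyticRank_of_analyticRank_le_one)
    (hCGS : CastellaGrossiSkinner2025.thmD_padicValRat_bsd_rank_le_one)
    (hGV : GreenbergVatsal2000.thm13_charIdeal_eq_of_gvPar) (hGr : greenberg_charValue_rankZero)
    (hmod : hasEntireLFunction_rat) (hmodP : nonempty_modularParametrizationData)
    (hcm : ¬ W.HasCM) (hr : W.analyticRank ≤ 1) (hgo : GoodOrd W p) (h5 : 5 ≤ p) :
    BSDp W p ∨ ClassX1 W p ∨ ClassX9 W p := by
  by_cases hX1 : ClassX1 W p
  · exact Or.inr (Or.inl hX1)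
  · by_cases hX9 : ClassX9 W p
    · exact Or.inr (Or.inr hX9)
    · exact Or.inl (bsdp_goodOrd_of_five_le_sharp hBCS hGZK hCGS hGV hGr hmod hmodP hcm hr hgo h5 hX1 hX9)

/-- **SHARP §A HEADLINE at `p ≥ 5`, EVERY `E/ℚ` (CM included): NINE named facts** — the seven of
`bsdp_goodOrd_of_five_le_sharp` plus, on the CM branch (where no corner is met at a good odd
prime, `Corners.bsdp_cm_of_good_or_mult_rankZero`), Rubin 1991 ∧ Burungale–Flach 2024 (`hCM`, rank
`0`) and Kobayashi 2013 Cor. 1.4 (`hKob`, rank `1`, PUB[sec] flag `KOB13-primary-unread`).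
[folklore] -/
theorem bsdp_goodOrd_of_five_le_allCurves_sharp
    (hBCS : BurungaleCastellaSkinner2025.cor131_padicValRat_bsd_rank_le_one)
    (hGZK : rank_eq_analyticRank_of_analyticRank_le_one)
    (hCGS : CastellaGrossiSkinner2025.thmD_padicValRat_bsd_rank_le_one)
    (hGV : GreenbergVatsal2000.thm13_charIdeal_eq_of_gvPar) (hGr : greenberg_charValue_rankZero)
    (hmod : hasEntireLFunction_rat) (hmodP : nonempty_modularParametrizationData)
    (hCM : bsdTriple_of_hasCM_of_L_one_ne_zero) (hKob : Kobayashi2013.cor14_bsdp_of_cm_rank_one)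
    (hr : W.analyticRank ≤ 1) (hgo : GoodOrd W p) (h5 : 5 ≤ p)
    (hX1 : ¬ ClassX1 W p) (hX9 : ¬ ClassX9 W p) : BSDp W p := by
  by_cases hcm : W.HasCM
  · exact bsdp_cm_of_good_or_mult_rankZero hCM hKob hmod hr hcm (by omega) (Or.inl hgo.1)
  · exact bsdp_goodOrd_of_five_le_sharp hBCS hGZK hCGS hGV hGr hmod hmodP hcm hr hgo h5 hX1 hX9

/-! ### The coordinator's domain at `p ≥ 5`: good ordinary, or multiplicative in rank `0` -/

/-- **SHARP, non-CM, `p ≥ 5`, 'good ORDINARY, or MULTIPLICATIVE with `r = 0`': EIGHT named facts.**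
For every non-CM `E/ℚ` of analytic rank `r ≤ 1` and every prime `p ≥ 5` such that `p` is good
ordinary, or `p` is multiplicative and `r = 0`, `BSD(E,p)` holds outside the four corners X1, X9
(ordinary axis) and X11a ('(ram) fails'), X2 (`E[p]` reducible) (multiplicative axis, RESIDUAL-MAP
§C), granted the seven facts of `bsdp_goodOrd_of_five_le_sharp` and Skinner 2016 Thm. C (`hSk`,
row C1). The good SUPERSINGULAR axis (§B: JSW 2017 Thm. 1.2.1 on `r = 1 ∧ sst`, corners X6 ∧ `r = 0`
/ X7) is deliberately not merged here — it is where `hJSW` and its flags live. [folklore] -/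
theorem bsdp_goodOrd_or_mult_of_five_le_sharp
    (hBCS : BurungaleCastellaSkinner2025.cor131_padicValRat_bsd_rank_le_one)
    (hGZK : rank_eq_analyticRank_of_analyticRank_le_one)
    (hCGS : CastellaGrossiSkinner2025.thmD_padicValRat_bsd_rank_le_one)
    (hGV : GreenbergVatsal2000.thm13_charIdeal_eq_of_gvPar) (hGr : greenberg_charValue_rankZero)
    (hmod : hasEntireLFunction_rat) (hmodP : nonempty_modularParametrizationData)
    (hSk : Skinner2016.thmC_padicValRat_bsd_rank_zero)
    (hcm : ¬ W.HasCM) (hr : W.analyticRank ≤ 1) (h5 : 5 ≤ p)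
    (hdom : GoodOrd W p ∨ (Mult W p ∧ W.analyticRank = 0))
    (hX1 : ¬ ClassX1 W p) (hX9 : ¬ ClassX9 W p) (hX11a : ¬ ClassX11a W p) (hX2 : ¬ ClassX2 W p) :
    BSDp W p := by
  rcases hdom with hgo | ⟨hm, hr0⟩
  · exact bsdp_goodOrd_of_five_le_sharp hBCS hGZK hCGS hGV hGr hmod hmodP hcm hr hgo h5 hX1 hX9
  · exact bsdp_mult_rankZero_of_not_corner hSk hmod hGZK (by omega) hm hr0 hX11a hX2

/-- **The same for EVERY `E/ℚ`: TEN named facts** (+ `hCM`, `hKob`; a CM curve is never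
multiplicative, and at a good odd prime it meets no corner). [folklore] -/
theorem bsdp_goodOrd_or_mult_of_five_le_allCurves_sharp
    (hBCS : BurungaleCastellaSkinner2025.cor131_padicValRat_bsd_rank_le_one)
    (hGZK : rank_eq_analyticRank_of_analyticRank_le_one)
    (hCGS : CastellaGrossiSkinner2025.thmD_padicValRat_bsd_rank_le_one)
    (hGV : GreenbergVatsal2000.thm13_charIdeal_eq_of_gvPar) (hGr : greenberg_charValue_rankZero)
    (hmod : hasEntireLFunction_rat) (hmodP : nonempty_modularParametrizationData)
    (hSk : Skinner2016.thmC_padicValRat_bsd_rank_zero)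
    (hCM : bsdTriple_of_hasCM_of_L_one_ne_zero) (hKob : Kobayashi2013.cor14_bsdp_of_cm_rank_one)
    (hr : W.analyticRank ≤ 1) (h5 : 5 ≤ p)
    (hdom : GoodOrd W p ∨ (Mult W p ∧ W.analyticRank = 0))
    (hX1 : ¬ ClassX1 W p) (hX9 : ¬ ClassX9 W p) (hX11a : ¬ ClassX11a W p) (hX2 : ¬ ClassX2 W p) :
    BSDp W p := by
  by_cases hcm : W.HasCM
  · refine bsdp_cm_of_good_or_mult_rankZero hCM hKob hmod hr hcm (by omega) ?_
    rcases hdom with hgo | ⟨hm, hr0⟩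
    · exact Or.inl hgo.1
    · exact Or.inr ⟨hm, hr0⟩
  · exact bsdp_goodOrd_or_mult_of_five_le_sharp hBCS hGZK hCGS hGV hGr hmod hmodP hSk hcm hr h5 hdom
      hX1 hX9 hX11a hX2

end Curve

end Summit.BirchSwinnertonDyer.Rank1Residual
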